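import Literature.AlgebraicGeometry.HodgeTheory.ClassesSupportedOnComplexification
import Literature.AlgebraicGeometry.HodgeTheory.HodgeFiltrationModelsReductionProofs
import Literature.AlgebraicGeometry.Motives.HodgeStructureLifting
import Literature.AlgebraicGeometry.Motives.HodgeStructureWeil
import HarnessLib

/-!
# Rational maps of bidegree `(r, r)` on the cohomology of smooth projective varieties are the
# morphisms of the `ℚ`-Hodge structures of their Hodge models (both directions)

Family `hodge`, layer `Literature/AlgebraicGeometry/HodgeTheory`. Voisin I, Def. 7.22: a morphism
of Hodge structures of type `(r, r)` from `(V, F)` of weight `a` to `(W, F)` of weight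
`b = a + 2r` is a `ℚ`-linear `φ : V → W` with `φ_ℂ(V^{p,q}) ⊆ W^{p+r,q+r}`, i.e. a morphism of
Hodge structures `V → W(r)` onto the Tate twist. On the tree's carriers such a map is given as a
`ℂ`-linear `f : Hᵃ(X(ℂ); ℂ) → Hᵇ(Y(ℂ); ℂ)` which maps rational classes to rational classes and
classes of type `(p, q)` (read in a Hodge model `A` of `X`) to classes of type `(p + r, q + r)`
(read in a Hodge model `B` of `Y`) — the binder shape of the route items of
`HodgeConjecture/SecondaryPeriods` and of `exists_rational_hodgeClass_corrAction_eq_smul`. This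
file passes between the two descriptions:

* `HodgeModel.exists_hom_of_typeShift` — carriers ⟹ abstract: `f` as above underlies a morphism
  `A.hodgeStructure hX hA a ⟶ T` into ANY Hodge structure `T` of weight `a` on `Hᵇ(Y(ℂ); ℚ)`
  whose pieces are `T^{p,q} = (B.hodgeStructure hY hB b)^{p+r,q+r}` (the Tate twist
  `(B.hodgeStructure hY hB b)(r)` transported to weight `a`, `piece_tateTwist`/`cast_piece`; for
  `r = 0`, `B.hodgeStructure hY hB b` itself), with `β_Y ∘ φ_ℂ = f ∘ β_X`
  (`β = ofRatClassBaseChange`, the comparison `ℂ ⊗_ℚ Hᵏ(–(ℂ); ℚ) ≅ Hᵏ(–(ℂ); ℂ)`);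
* `HodgeModel.typeShift_of_hom` — abstract ⟹ carriers: conversely the carrier map
  `β_Y ∘ φ_ℂ ∘ β_X⁻¹` of such a morphism maps rational classes to rational classes and type
  `(p, q)` to type `(p + r, q + r)`; `HodgeModel.exists_carrier_of_hom` packages the carrier map.

Everything is proved; no definition, no named fact (the morphism constructor is the tree's
`Motives.HodgeStructure.Hom.exists_of_mapPieceLe`).

## References

* [VoisinHodgeI2002] C. Voisin, Hodge Theory and Complex Algebraic Geometry I, §7.1.1, §7.3.1
  Def. 7.22, §7.3.2.
* [DeligneHodgeII1971] P. Deligne, Théorie de Hodge II, 1.2.5, 2.1.13–2.1.14.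
-/

noncomputable section

open scoped TensorProduct
open CategoryTheory AlgebraicGeometry
open Literature.AlgebraicTopology.SingularHomology

namespace Literature.AlgebraicGeometry.HodgeTheory

section HodgeTheory

variable {n m : ℕ} {X Y : Motives.SchemeOver ℂ}

/-! ### Descending a lattice-preserving map to the rational lattices -/

/-- **A `ℂ`-linear map `Hᵃ(X(ℂ); ℂ) → Hᵇ(Y(ℂ); ℂ)` mapping rational classes to rational classes
restricts to a `ℚ`-linear map `Hᵃ(X(ℂ); ℚ) → Hᵇ(Y(ℂ); ℚ)` of the rational lattices**
(`ofRatClass` is injective and additive, `ofRatClass (q • v) = q • ofRatClass v`).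
[cite: VoisinHodgeI2002, §7.1.1] -/
theorem exists_ratLinearMap_ofRatClass_eq {a b : ℕ}
    (f : complexBetti X a →ₗ[ℂ] complexBetti Y b) (hf : ∀ c, IsRationalClass c → IsRationalClass (f c)) :
    ∃ fq : Motives.bettiCohomology X a →ₗ[ℚ] Motives.bettiCohomology Y b,
      ∀ v, ofRatClass (Motives.ComplexPoints Y) b (fq v) = f (ofRatClass (Motives.ComplexPoints X) a v) := by
  have key : ∀ v : Motives.bettiCohomology X a, ∃ w : Motives.bettiCohomology Y b,
      ofRatClass (Motives.ComplexPoints Y) b w = f (ofRatClass (Motives.ComplexPoints X) a v) := fun v ↦ by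
    obtain ⟨w, hw⟩ := (isRationalClass_iff_mem_range_ofRatClass _).1 (hf _ (isRationalClass_ofRatClass v))
    exact ⟨w, hw⟩
  choose w hw using key
  have hinj := ofRatClass_injective (Y := Motives.ComplexPoints Y) b
  refine ⟨{ toFun := w
            map_add' := fun v v' ↦ hinj ?_
            map_smul' := fun q v ↦ hinj ?_ }, fun v ↦ hw v⟩
  · rw [map_add, hw, hw, hw, map_add, map_add]
  · rw [RingHom.id_apply, Motives.ofRatClass_smul, hw, hw, Motives.ofRatClass_smul, map_smul]

/-! ### Carriers ⟹ abstract: a rational map of bidegree `(r, r)` is a morphism onto the Tate twist -/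

/-- **A rational type-`(r, r)` map on the carriers is a morphism of the Hodge structures of the
models** (Voisin I Def. 7.22 / §7.3.2). Let `X`, `Y` be smooth projective with Hodge symmetric
models `A`, `B`, and `f : Hᵃ(X(ℂ); ℂ) → Hᵇ(Y(ℂ); ℂ)`, `b = a + 2r`, `ℂ`-linear, mapping rational
classes to rational classes and, for `p + q = a`, classes whose `A`-pull-back lies in `H^{p,q}`
to classes whose `B`-pull-back lies in `H^{p+r,q+r}`. Then the restriction `fq` of `f` to the
rational lattices (`exists_ratLinearMap_ofRatClass_eq`) is a morphism of Hodge structures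
`A.hodgeStructure a ⟶ (B.hodgeStructure b)(r)` (weight `b − 2r = a`), and `β_Y ∘ (fq ⊗ ℂ) = f ∘ β_X`
for the comparisons `β = ofRatClassBaseChange`. Pieces: `V^{p,q} = Θ_A⁻¹(H^{p,q})`
(`piece_eq_ratPiece`) for `p, q ≥ 0`, and `⊥` otherwise. [cite: VoisinHodgeI2002, §7.3.1 Def. 7.22 and §7.3.2] -/
theorem HodgeModel.exists_hom_of_typeShift (hX : Motives.IsSmoothProjective n X)
    (hY : Motives.IsSmoothProjective m Y) (A : HodgeModel n X) (hA : A.IsHodgeSymmetric)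
    (B : HodgeModel m Y) (hB : B.IsHodgeSymmetric) {a b r : ℕ} (hab : a + 2 * r = b)
    (T : Motives.HodgeStructure (Motives.bettiCohomology Y b) ((a : ℕ) : ℤ))
    (hT : ∀ p q : ℤ, T.piece p q = (B.hodgeStructure hY hB b).piece (p + r) (q + r))
    (f : complexBetti X a →ₗ[ℂ] complexBetti Y b) (hf : ∀ c, IsRationalClass c → IsRationalClass (f c))
    (hfH : ∀ (p q : ℕ), p + q = a → ∀ c, A.pullback a c ∈ A.hodgePQ a p q →
      B.pullback b (f c) ∈ B.hodgePQ b (p + r) (q + r)) :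
    ∃ φ : Motives.HodgeStructure.Hom (A.hodgeStructure hX hA a) T,
      ∀ x, Motives.ofRatClassBaseChange (Motives.ComplexPoints Y) b (φ.toLinearMap.baseChange ℂ x) =
        f (Motives.ofRatClassBaseChange (Motives.ComplexPoints X) a x) := by
  classical
  obtain ⟨fq, hfq⟩ := exists_ratLinearMap_ofRatClass_eq f hf
  -- `β_Y ∘ (fq ⊗ ℂ) = f ∘ β_X`
  have hcomm : ∀ x, Motives.ofRatClassBaseChange (Motives.ComplexPoints Y) b (fq.baseChange ℂ x) =
      f (Motives.ofRatClassBaseChange (Motives.ComplexPoints X) a x) := by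
    intro x
    induction x using TensorProduct.induction_on with
    | zero => simp only [map_zero]
    | tmul c v =>
      rw [LinearMap.baseChange_tmul, Motives.ofRatClassBaseChange_tmul, Motives.ofRatClassBaseChange_tmul,
        map_smul, hfq]
    | add x y hx hy => simp only [map_add, hx, hy]
  suffices hpiece : ∀ P Q : ℤ, P + Q = ((a : ℕ) : ℤ) →
      ((A.hodgeStructure hX hA a).piece P Q).map (fq.baseChange ℂ) ≤ T.piece P Q by
    obtain ⟨φ, hφ⟩ := Motives.HodgeStructure.Hom.exists_of_mapPieceLe _ _ fq hpiece
    exact ⟨φ, fun x ↦ by rw [hφ]; exact hcomm x⟩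
  intro P Q hPQ
  rintro _ ⟨x, hx, rfl⟩
  rw [SetLike.mem_coe] at hx
  -- off the effective range the source piece vanishes
  by_cases hP : 0 ≤ P
  swap
  · rw [Motives.HodgeStructure.mem_piece_iff _ hPQ, HodgeModel.hodgeStructure_F, HodgeModel.hodgeStructure_F,
      A.ratF_eq_bot hX a (show ((a : ℕ) : ℤ) < Q by omega), Submodule.mem_bot] at hx
    have hx0 : x = 0 := by
      have hc : Motives.HodgeStructure.conj x = 0 := hx.2
      have := congrArg Motives.HodgeStructure.conj hc
      rwa [Motives.HodgeStructure.conj_conj, map_zero] at this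
    rw [hx0, map_zero]
    exact Submodule.zero_mem _
  by_cases hQ : 0 ≤ Q
  swap
  · rw [Motives.HodgeStructure.mem_piece_iff _ hPQ, HodgeModel.hodgeStructure_F,
      A.ratF_eq_bot hX a (show ((a : ℕ) : ℤ) < P by omega), Submodule.mem_bot] at hx
    rw [hx.1, map_zero]
    exact Submodule.zero_mem _
  -- `P = p`, `Q = q` naturals with `p + q = a`
  obtain ⟨p, rfl⟩ : ∃ p : ℕ, (p : ℤ) = P := ⟨P.toNat, Int.toNat_of_nonneg hP⟩
  obtain ⟨q, rfl⟩ : ∃ q : ℕ, (q : ℤ) = Q := ⟨Q.toNat, Int.toNat_of_nonneg hQ⟩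
  have hpq : p + q = a := by omega
  rw [A.piece_eq_ratPiece hX hA hpq, HodgeModel.mem_ratPiece_iff, HodgeModel.complexification_apply] at hx
  have hps : ((p : ℤ) + r) = ((p + r : ℕ) : ℤ) := by push_cast; ring
  have hqs : ((q : ℤ) + r) = ((q + r : ℕ) : ℤ) := by push_cast; ring
  rw [hT, hps, hqs,
    B.piece_eq_ratPiece hY hB (show (p + r) + (q + r) = b by omega), HodgeModel.mem_ratPiece_iff,
    HodgeModel.complexification_apply, hcomm]
  exact hfH p q hpq _ hx

/-! ### Abstract ⟹ carriers: a morphism onto the Tate twist is a rational map of bidegree `(r, r)` -/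

/-- **Conversely, a morphism `A.hodgeStructure a ⟶ (B.hodgeStructure b)(r)` is a rational map of
bidegree `(r, r)` on the carriers**: if `f : Hᵃ(X(ℂ); ℂ) → Hᵇ(Y(ℂ); ℂ)` satisfies
`β_Y ∘ (φ ⊗ ℂ) = f ∘ β_X`, then `f` maps rational classes to rational classes
(`φ_ℂ (1 ⊗ v) = 1 ⊗ φ v`) and classes of type `(p, q)` in `A` to classes of type `(p + r, q + r)`
in `B` (`Hom.map_piece_le`, `piece_eq_ratPiece`, `piece_tateTwist`).
[cite: VoisinHodgeI2002, §7.3.1 Def. 7.22 and §7.3.2] -/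
theorem HodgeModel.typeShift_of_hom (hX : Motives.IsSmoothProjective n X)
    (hY : Motives.IsSmoothProjective m Y) (A : HodgeModel n X) (hA : A.IsHodgeSymmetric)
    (B : HodgeModel m Y) (hB : B.IsHodgeSymmetric) {a b r : ℕ} (hab : a + 2 * r = b)
    (T : Motives.HodgeStructure (Motives.bettiCohomology Y b) ((a : ℕ) : ℤ))
    (hT : ∀ p q : ℤ, T.piece p q = (B.hodgeStructure hY hB b).piece (p + r) (q + r))
    (φ : Motives.HodgeStructure.Hom (A.hodgeStructure hX hA a) T)
    (f : complexBetti X a →ₗ[ℂ] complexBetti Y b)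
    (hf : ∀ x, Motives.ofRatClassBaseChange (Motives.ComplexPoints Y) b (φ.toLinearMap.baseChange ℂ x) =
      f (Motives.ofRatClassBaseChange (Motives.ComplexPoints X) a x)) :
    (∀ c, IsRationalClass c → IsRationalClass (f c)) ∧
      ∀ (p q : ℕ), p + q = a → ∀ c, A.pullback a c ∈ A.hodgePQ a p q →
        B.pullback b (f c) ∈ B.hodgePQ b (p + r) (q + r) := by
  have hβX := ofRatClassBaseChange_surjective hX a
  constructor
  · intro c hc
    obtain ⟨v, rfl⟩ := (isRationalClass_iff_mem_range_ofRatClass c).1 hc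
    rw [← ofRatClassBaseChange_ofRat, ← hf, Motives.HodgeStructure.baseChange_ofRat,
      ofRatClassBaseChange_ofRat]
    exact isRationalClass_ofRatClass _
  · intro p q hpq c hc
    obtain ⟨x, rfl⟩ := hβX c
    -- `x ∈ V^{p,q}` of `A.hodgeStructure`
    have hx : x ∈ (A.hodgeStructure hX hA a).piece p q := by
      rw [A.piece_eq_ratPiece hX hA hpq, HodgeModel.mem_ratPiece_iff, HodgeModel.complexification_apply]
      exact hc
    have hφx := φ.map_piece_le p q ⟨x, hx, rfl⟩
    have hps : ((p : ℤ) + r) = ((p + r : ℕ) : ℤ) := by push_cast; ring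
    have hqs : ((q : ℤ) + r) = ((q + r : ℕ) : ℤ) := by push_cast; ring
    rw [hT, hps, hqs,
      B.piece_eq_ratPiece hY hB (show (p + r) + (q + r) = b by omega), HodgeModel.mem_ratPiece_iff,
      HodgeModel.complexification_apply, hf] at hφx
    exact hφx

/-- The carrier map of a morphism `A.hodgeStructure a ⟶ (B.hodgeStructure b)(r)`:
`β_Y ∘ (φ ⊗ ℂ) ∘ β_X⁻¹`, with its defining compatibility. [cite: VoisinHodgeI2002, §7.3.2] -/
theorem HodgeModel.exists_carrier_of_hom (hX : Motives.IsSmoothProjective n X)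
    (hY : Motives.IsSmoothProjective m Y) (A : HodgeModel n X) (hA : A.IsHodgeSymmetric)
    (B : HodgeModel m Y) (hB : B.IsHodgeSymmetric) {a b r : ℕ} (hab : a + 2 * r = b)
    (T : Motives.HodgeStructure (Motives.bettiCohomology Y b) ((a : ℕ) : ℤ))
    (hT : ∀ p q : ℤ, T.piece p q = (B.hodgeStructure hY hB b).piece (p + r) (q + r))
    (φ : Motives.HodgeStructure.Hom (A.hodgeStructure hX hA a) T) :
    ∃ f : complexBetti X a →ₗ[ℂ] complexBetti Y b,
      (∀ x, Motives.ofRatClassBaseChange (Motives.ComplexPoints Y) b (φ.toLinearMap.baseChange ℂ x) =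
        f (Motives.ofRatClassBaseChange (Motives.ComplexPoints X) a x)) ∧
      (∀ c, IsRationalClass c → IsRationalClass (f c)) ∧
      ∀ (p q : ℕ), p + q = a → ∀ c, A.pullback a c ∈ A.hodgePQ a p q →
        B.pullback b (f c) ∈ B.hodgePQ b (p + r) (q + r) := by
  set f : complexBetti X a →ₗ[ℂ] complexBetti Y b :=
    (ofRatClassBaseChangeEquiv hY b).toLinearMap ∘ₗ (φ.toLinearMap.baseChange ℂ) ∘ₗ
      (ofRatClassBaseChangeEquiv hX a).symm.toLinearMap with hfdef
  have hf : ∀ x, Motives.ofRatClassBaseChange (Motives.ComplexPoints Y) b (φ.toLinearMap.baseChange ℂ x) =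
      f (Motives.ofRatClassBaseChange (Motives.ComplexPoints X) a x) := by
    intro x
    rw [hfdef, LinearMap.comp_apply, LinearMap.comp_apply, ← ofRatClassBaseChangeEquiv_apply hX a,
      LinearEquiv.coe_toLinearMap, LinearEquiv.coe_toLinearMap, LinearEquiv.symm_apply_apply,
      ofRatClassBaseChangeEquiv_apply]
  exact ⟨f, hf, HodgeModel.typeShift_of_hom hX hY A hA B hB hab T hT φ f hf⟩

/-- The pieces of the Tate twist `(B.hodgeStructure hY hB b)(r)` transported to weight `a = b − 2r`:
the hypothesis `hT` of the lemmas above for the twisted target. [cite: DeligneHodgeII1971, 2.1.13] -/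
theorem HodgeModel.piece_tateTwist_cast (hY : Motives.IsSmoothProjective m Y) (B : HodgeModel m Y)
    (hB : B.IsHodgeSymmetric) {a b r : ℕ} (hw : ((b : ℕ) : ℤ) - 2 * (r : ℤ) = ((a : ℕ) : ℤ))
    (p q : ℤ) :
    (((B.hodgeStructure hY hB b).tateTwist r).cast hw).piece p q =
      (B.hodgeStructure hY hB b).piece (p + r) (q + r) := by
  rw [Motives.HodgeStructure.cast_piece, Motives.piece_tateTwist]

end HodgeTheory

end Literature.AlgebraicGeometry.HodgeTheory

end
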